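import Summits.BirchSwinnertonDyer.Rank1Residual.X11b.UnrIntegersTeichmuller
import Summits.BirchSwinnertonDyer.Rank1Residual.X11b.KummerTwistIntersectionPadic
import Literature.NumberTheory.EllipticCurves.UnrIntegersUnits
import HarnessLib

/-!
# X11b — structure of the tree's `R₀ = unrIntegers p ⊂ ℂ_p`, II: `R₀` is the VALUATION RING
# of `Frac R₀`, `Frac R₀` is DISCRETELY valued and CLOSED, has no `ζ_p` (`p` odd) — and the
# TWIST-INTERSECTION LEMMA OVER `Frac R₀`, unconditionally

HONEST FRAMING (cell `b2b-bsdres`, run/shared/lean/b2b/bsd-rank1-residual/, verbatim in every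
file): the goal of the cell is to DELETE the COMBINATION-SHAPED residual classes of the
Birch–Swinnerton-Dyer formula for ALL analytic-rank `≤ 1` elliptic curves over `ℚ` — "full BSD
formula for every rank `≤ 1` curve in class `C`" assembled STRICTLY from published theorems — so
that the rank-`≤ 1` remainder becomes exactly the CONSTRUCTION-SHAPED classes, which are TYPED
(missing-input `Prop`s), NOT attempted. This is not "finishing BSD". Sub-cell
`b2b-bsdres-multr1-p1` (X11b, route R1, gen 24); THEOREMS ONLY (no definition, no named fact, no
`sorry`); elementary `p`-adic analysis about the Literature definition `unrIntegers p`
("`R₀ = 𝒪(\widehat{ℚ_p^ur})`", Castella 2018 §3); nothing about any curve; nothing at `p = 3` is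
claimed beyond these every-`p` algebra facts.

## What this file proves (`L := Subfield.closure R₀ = Frac R₀ = R₀[1/p] ⊂ ℂ_p`)

* UNITS are IMPORTED: `u ∈ R₀`, `‖u‖ = 1 ⟹ u⁻¹ ∈ R₀` is x11b3-lit1's
  `unrIntegers.inv_mem_of_norm_eq_one` (`Literature/…/UnrIntegersUnits.lean`, p265208, pigeonhole
  proof), landed minutes before this file; it is used, not re-proved.
* §5 `R1.mem_unrIntegers_of_mem_fracUnr` (`w ∈ L`, `‖w‖ ≤ 1 ⟹ w ∈ R₀`: `R₀` is the valuation ring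
  of `L` — hypothesis `hR` of gen 23's `R1.coeff_mem_subring_of_hasValueAt_mem`),
  `R1.exists_norm_eq_zpow_of_mem_fracUnr` (`L` is DISCRETELY valued: `‖w‖ ∈ p^ℤ` — input (U-a) of
  `KummerTwistIntersectionPadic.lean`), `R1.isClosed_fracUnr` (`L` is closed in `ℂ_p` — hypothesis
  `hS` of gen 23's `R1.coeff_mem_of_hasValueAt_mem`).
* §6 `R1.fracUnr_pow_eq_one_imp_eq_one` (`p ≠ 2`: no `ζ_p` in `L`);
  **`R1.mem_fracUnr_of_forall_mem_closure`**: for `p ≠ 2`, `u ∈ L ∖ {0}`, `x^{p^a} = u`,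
  `(∀ η, η^{p^a} = 1 → y ∈ Subfield.closure (L ∪ {ηx})) → y ∈ L` — STEP B of the `R₀`-descent
  (`⋂_ε Frac 𝒲_{ψε} = Frac R₀`, DESCENT-NOTE §2/§2′) as an UNCONDITIONAL kernel theorem over the
  tree's `R₀`; **`R1.mem_unrIntegers_of_forall_mem_closure`**: with `u ∈ R₀` and `‖y‖ ≤ 1`, `y ∈ R₀`
  (`⋂_ε 𝒲_{ψε} = R₀`).

With Part I, gen 23's `BDPFrameUniquenessInt.lean` (STEP A at fixed periods; descent of
coefficients from values with `S = L`, now with `hS`, `hR` PROVED) and `KummerTwistIntersection*`,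
every KERNEL ingredient of the half-page descent behind "`L_p(f) ∈ Λ_{R₀}`" is in the tree; what is
not kernel is page-level ((W)/(W₃): which scalars of the construction depend on `ψ`/`λ`) and the
supply of characters — lit's and x11b3's readings, not this seat's. Not load-bearing for route R1.

References: [Castella2018] §3 (p. 9), p. 9 ll. 42–47; [Cassels1986] Ch. 4, Ch. 6 (valuation ring
of `\widehat{ℚ_p^ur}`, Teichmüller units; folklore).
-/

noncomputable section

open scoped Classical Topology

open Filter Literature.NumberTheory.EllipticCurves
open Literature.NumberTheory.LFunctions.Dwork (norm_natCast_p_padicComplex)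

namespace Summit.BirchSwinnertonDyer.Rank1Residual.X11b

/-! ### §5 `R₀` is the valuation ring of `Frac R₀`; `Frac R₀` is discretely valued and closed -/

section ValuationRing

variable {p : ℕ} [hp : Fact p.Prime]

/-- `‖y‖ ≤ p^{−k}` with `y ∈ R₀` ⟹ `y / p^k ∈ R₀`. [folklore] -/
theorem R1.div_pow_mem_unrIntegers {y : ℂ_[p]} (hy : y ∈ unrIntegers p) {k : ℕ}
    (hyk : ‖y‖ ≤ (p : ℝ)⁻¹ ^ k) : y / (p : ℂ_[p]) ^ k ∈ unrIntegers p := by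
  have hp' : p.Prime := hp.out
  rcases eq_or_ne y 0 with rfl | hy0
  · simp
  obtain ⟨n, hn, hmem⟩ := R1.exists_norm_eq_inv_pow hy hy0
  have hpinv : (p : ℝ)⁻¹ < 1 := inv_lt_one_of_one_lt₀ (by exact_mod_cast hp'.one_lt)
  have hpinv0 : 0 < (p : ℝ)⁻¹ := inv_pos.mpr (by exact_mod_cast hp'.pos)
  have hkn : k ≤ n := by
    by_contra h
    have := pow_lt_pow_right_of_lt_one₀ hpinv0 hpinv (not_le.mp h)
    rw [← hn] at this
    exact (lt_irrefl _) (this.trans_le hyk)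
  have hp0 : (p : ℂ_[p]) ≠ 0 := by exact_mod_cast hp'.ne_zero
  have e : y / (p : ℂ_[p]) ^ k = y / (p : ℂ_[p]) ^ n * (p : ℂ_[p]) ^ (n - k) := by
    rw [eq_comm, div_mul_eq_mul_div, div_eq_div_iff (pow_ne_zero _ hp0) (pow_ne_zero _ hp0),
      mul_assoc, ← pow_add, Nat.sub_add_cancel hkn]
  rw [e]
  exact mul_mem hmem (Subring.pow_mem _ (natCast_mem (unrIntegers p) p) _)

/-- **`R₀` is the valuation ring of `Frac R₀ = R₀[1/p]`**: an element of the subfield of `ℂ_p`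
generated by `R₀` of norm `≤ 1` lies in `R₀` (write it `y/z`, rescale by `p^{ord z}`, invert the
norm-one denominator by `unrIntegers.inv_mem_of_norm_eq_one`). This is the hypothesis `hR` of
gen 23's `R1.coeff_mem_subring_of_hasValueAt_mem` for `S = Frac R₀`, `R = R₀`. [folklore] -/
theorem R1.mem_unrIntegers_of_mem_fracUnr {w : ℂ_[p]}
    (hw : w ∈ Subfield.closure (unrIntegers p : Set ℂ_[p])) (hw1 : ‖w‖ ≤ 1) :
    w ∈ unrIntegers p := by
  have hp' : p.Prime := hp.out
  obtain ⟨y, hy, z, hz, rfl⟩ := Subfield.mem_closure_iff.mp hw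
  rw [Subring.closure_eq] at hy hz
  rcases eq_or_ne z 0 with rfl | hz0
  · simp
  obtain ⟨b, hb, hzb⟩ := R1.exists_norm_eq_inv_pow hz hz0
  have hp0 : (p : ℂ_[p]) ≠ 0 := by exact_mod_cast hp'.ne_zero
  have hzb1 : ‖z / (p : ℂ_[p]) ^ b‖ = 1 := by
    rw [norm_div, norm_pow, norm_natCast_p_padicComplex, hb, div_self]
    exact pow_ne_zero _ (inv_ne_zero (by exact_mod_cast hp'.ne_zero))
  have hyb : y / (p : ℂ_[p]) ^ b ∈ unrIntegers p := by
    refine R1.div_pow_mem_unrIntegers hy ?_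
    have : ‖y‖ = ‖y / z‖ * ‖z‖ := by
      rw [norm_div, div_mul_cancel₀ _ (norm_ne_zero_iff.mpr hz0)]
    rw [this, ← hb]
    exact mul_le_of_le_one_left (norm_nonneg _) hw1
  have e : y / z = y / (p : ℂ_[p]) ^ b * (z / (p : ℂ_[p]) ^ b)⁻¹ := by
    rw [← div_eq_mul_inv, div_div_div_cancel_right₀ (pow_ne_zero _ hp0)]
  rw [e]
  exact mul_mem hyb (unrIntegers.inv_mem_of_norm_eq_one hzb hzb1)

/-- **`Frac R₀` is discretely valued**: every non-zero element of the subfield of `ℂ_p` generated by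
`R₀` has norm `p^n`, `n ∈ ℤ` — the input (U-a) of `KummerTwistIntersectionPadic.lean`. [folklore] -/
theorem R1.exists_norm_eq_zpow_of_mem_fracUnr {w : ℂ_[p]}
    (hw : w ∈ Subfield.closure (unrIntegers p : Set ℂ_[p])) (hw0 : w ≠ 0) :
    ∃ n : ℤ, ‖w‖ = (p : ℝ) ^ n := by
  obtain ⟨y, hy, z, hz, rfl⟩ := Subfield.mem_closure_iff.mp hw
  rw [Subring.closure_eq] at hy hz
  have hy0 : y ≠ 0 := fun h ↦ hw0 (by simp [h])
  have hz0 : z ≠ 0 := fun h ↦ hw0 (by simp [h])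
  obtain ⟨a, ha, -⟩ := R1.exists_norm_eq_inv_pow hy hy0
  obtain ⟨b, hb, -⟩ := R1.exists_norm_eq_inv_pow hz hz0
  refine ⟨(b : ℤ) - a, ?_⟩
  have hp0 : (p : ℝ) ≠ 0 := by exact_mod_cast hp.out.ne_zero
  rw [norm_div, ha, hb, inv_pow, inv_pow, zpow_sub₀ hp0, zpow_natCast, zpow_natCast]
  field_simp

/-- **`Frac R₀` is closed in `ℂ_p`** (it is complete: `R₀` is closed and the valuation discrete) —
the hypothesis `hS` of gen 23's `R1.coeff_mem_of_hasValueAt_mem` for `S = Frac R₀`. [folklore] -/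
theorem R1.isClosed_fracUnr :
    IsClosed (Subfield.closure (unrIntegers p : Set ℂ_[p]) : Set ℂ_[p]) := by
  have hp' : p.Prime := hp.out
  refine IsSeqClosed.isClosed fun x w hxL hlim ↦ ?_
  rcases eq_or_ne w 0 with rfl | hw0
  · exact (Subfield.closure _).zero_mem
  -- eventually `‖x k‖ = ‖w‖ = p^n`
  have hev : ∀ᶠ k in atTop, ‖x k - w‖ < ‖w‖ :=
    (tendsto_iff_norm_sub_tendsto_zero.mp hlim).eventually (gt_mem_nhds (norm_pos_iff.mpr hw0))
  have hnorm : ∀ k, ‖x k - w‖ < ‖w‖ → ‖x k‖ = ‖w‖ := fun k hk ↦ by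
    have e : x k = w + (x k - w) := by ring
    rw [e, IsUltrametricDist.norm_add_eq_max_of_norm_ne_norm (ne_of_lt hk).symm, max_eq_left hk.le]
  obtain ⟨k₀, hk₀⟩ := hev.exists
  have hxk₀ : x k₀ ≠ 0 := norm_pos_iff.mp (by rw [hnorm k₀ hk₀]; exact norm_pos_iff.mpr hw0)
  obtain ⟨n, hn⟩ := R1.exists_norm_eq_zpow_of_mem_fracUnr (hxL k₀) hxk₀
  rw [hnorm k₀ hk₀] at hn
  -- rescale by `p^m`, `m ≥ n`
  obtain ⟨m, hm⟩ : ∃ m : ℕ, n ≤ m := ⟨n.toNat, Int.self_le_toNat n⟩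
  have hp0 : (p : ℂ_[p]) ≠ 0 := by exact_mod_cast hp'.ne_zero
  have hpR : (1 : ℝ) ≤ p := by exact_mod_cast hp'.one_lt.le
  have hsmall : ∀ k, ‖x k - w‖ < ‖w‖ → ‖(p : ℂ_[p]) ^ m * x k‖ ≤ 1 := fun k hk ↦ by
    rw [norm_mul, norm_pow, norm_natCast_p_padicComplex, hnorm k hk, hn, inv_pow, ← zpow_natCast,
      ← zpow_neg, ← zpow_add₀ (by exact_mod_cast hp'.ne_zero)]
    exact zpow_le_one_of_nonpos₀ hpR (by omega)
  have hmemR : ∀ᶠ k in atTop, (p : ℂ_[p]) ^ m * x k ∈ unrIntegers p := by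
    filter_upwards [hev] with k hk
    exact R1.mem_unrIntegers_of_mem_fracUnr
      (mul_mem (Subfield.subset_closure (Subring.pow_mem _
        (natCast_mem (unrIntegers p) p) _)) (hxL k)) (hsmall k hk)
  have hlim' : Tendsto (fun k ↦ (p : ℂ_[p]) ^ m * x k) atTop (𝓝 ((p : ℂ_[p]) ^ m * w)) :=
    hlim.const_mul _
  have hwR : (p : ℂ_[p]) ^ m * w ∈ unrIntegers p := isClosed_unrIntegers.mem_of_tendsto hlim' hmemR
  have e : w = (p : ℂ_[p]) ^ m * w / (p : ℂ_[p]) ^ m :=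
    (mul_div_cancel_left₀ w (pow_ne_zero _ hp0)).symm
  rw [e]
  exact div_mem (Subfield.subset_closure hwR)
    (Subfield.subset_closure (Subring.pow_mem _ (natCast_mem (unrIntegers p) p) _))

end ValuationRing

/-! ### §6 No `ζ_p` in `Frac R₀` (`p` odd); the twist-intersection lemma over `Frac R₀` -/

section TwistIntersection

variable {p : ℕ} [hp : Fact p.Prime]

/-- **`Frac R₀` has no primitive `p`-th root of unity (`p` odd)**: it is discretely valued (§5) and
`‖ζ_p − 1‖ = p^{−1/(p−1)} ∉ p^ℤ` (`KummerTwistIntersectionPadic`). [folklore] -/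
theorem R1.fracUnr_pow_eq_one_imp_eq_one (hp2 : p ≠ 2) :
    ∀ z ∈ Subfield.closure (unrIntegers p : Set ℂ_[p]), z ^ p = 1 → z = 1 :=
  R1.pow_eq_one_imp_eq_one_of_norm_zpow hp2 _ fun _ hw hw0 ↦
    R1.exists_norm_eq_zpow_of_mem_fracUnr hw hw0

/-- **TWIST-INTERSECTION OVER `Frac R₀` (unconditional; `p` odd).** `L := Frac R₀ ⊂ ℂ_p`,
`u ∈ L ∖ {0}`, `x^{p^a} = u`: if `y` lies in the subfield generated by `L` and `ηx` for EVERY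
`p^a`-th root of unity `η ∈ ℂ_p`, then `y ∈ L` — STEP B of the `R₀`-descent (DESCENT-NOTE §2/§2′:
`⋂_ε Frac 𝒲_{ψε} = Frac R₀`) as a kernel theorem over the tree's `unrIntegers p`. [folklore] -/
theorem R1.mem_fracUnr_of_forall_mem_closure (hp2 : p ≠ 2) {a : ℕ} {u : ℂ_[p]}
    (hu : u ∈ Subfield.closure (unrIntegers p : Set ℂ_[p])) (hu0 : u ≠ 0) {x : ℂ_[p]}
    (hx : x ^ p ^ a = u) {y : ℂ_[p]}
    (hy : ∀ η : ℂ_[p], η ^ p ^ a = 1 →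
      y ∈ Subfield.closure
        ((Subfield.closure (unrIntegers p : Set ℂ_[p]) : Set ℂ_[p]) ∪ {η * x})) :
    y ∈ Subfield.closure (unrIntegers p : Set ℂ_[p]) :=
  R1.mem_subfield_padic_of_forall_mem_closure hp2 _
    (fun _ hw hw0 ↦ R1.exists_norm_eq_zpow_of_mem_fracUnr hw hw0) hu hu0 hx hy

/-- **… and `R₀`-integrality**: if moreover `‖y‖ ≤ 1` (e.g. `y` a coefficient of an element of
`𝓞_{ℂ_p}⟦T⟧`) then `y ∈ R₀` — `⋂_ε 𝒲_{ψε} = R₀` for `u ∈ R₀ ∖ {0}` (§5 valuation ring).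
[folklore] -/
theorem R1.mem_unrIntegers_of_forall_mem_closure (hp2 : p ≠ 2) {a : ℕ} {u : ℂ_[p]}
    (hu : u ∈ unrIntegers p) (hu0 : u ≠ 0) {x : ℂ_[p]} (hx : x ^ p ^ a = u) {y : ℂ_[p]}
    (hy : ∀ η : ℂ_[p], η ^ p ^ a = 1 →
      y ∈ Subfield.closure ((unrIntegers p : Set ℂ_[p]) ∪ {η * x})) (hy1 : ‖y‖ ≤ 1) :
    y ∈ unrIntegers p := by
  refine R1.mem_unrIntegers_of_mem_fracUnr (R1.mem_fracUnr_of_forall_mem_closure hp2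
    (Subfield.subset_closure hu) hu0 hx fun η hη ↦ ?_) hy1
  exact Subfield.closure_mono (Set.union_subset_union_left _ Subfield.subset_closure) (hy η hη)

end TwistIntersection

end Summit.BirchSwinnertonDyer.Rank1Residual.X11b

end
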